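import Mathlib
import Summits.MatrixMultiplication.MatrixMultiplication.Theses.FidelityWitnesses
import Literature.Computability.AlgebraicComplexity.FlatteningBound
import Summits.MatrixMultiplication.MatrixMultiplication.Theorems.FidelityWitnessesRankTwoAdditivityNorms
import Summits.MatrixMultiplication.MatrixMultiplication.Theorems.FidelityWitnessesFlatteningWitness

/-!
# `FidelityWitnesses.RankTwoAdditivity` (stmt-MatrixMultiplication-4964) — reduction to the core inequality

`RankTwoAdditivity` says `M(n,2) = 2`: for every tensor `S ∈ ℂ^{(n×n)×(n×n)×(n×n)}` of rank `≤ 2`,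
`|⟨S, ⟨n,n,n⟩⟩|² ≤ 2 ‖S‖²`.  This file proves, sorry-free, that the statement follows from the
**core four-matrix inequality**: for complex arrays `X₁,X₂ ∈ ℂ^{ι×κ}`, `Y₁,Y₂ ∈ ℂ^{κ×μ}` with
products `A = X₁Y₁`, `B = X₂Y₂`, `n_l = ‖X_l‖²‖Y_l‖²`, `p = ⟨X₁,X₂⟩⟨Y₁,Y₂⟩`,

  `n₁‖B‖² + n₂‖A‖² + 2|p|² ≤ 2 n₁ n₂ + 2 Re(p̄ ⟨A,B⟩)`        (CORE)

(the hypothesis `hcore` below, spelled out in coordinates).  Steps: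

* `triad_contraction`, `contraction_two` (with `flatteningWitness_contraction`): contracting a sum of two triads
  `w₁⊗u₁⊗v₁ + w₂⊗u₂⊗v₂` against `⟨n,n,n⟩` gives `Σ_a (w₁(a) A(a) + w₂(a) B(a))` with `A = X₁Y₁`,
  `B = X₂Y₂` (`X_l = u_l`, `Y_l = v_l` as matrices);
* `zstep_one`: exact elimination of the third factor `w` — two Cauchy–Schwarz steps against the
  auxiliary arrays `U = n₁ w̄₁ + p̄ w̄₂`, `D = n₁ B − p A`, whose defect `‖D‖² ≤ (2n₁ − ‖A‖²)(n₁n₂ − |p|²)`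
  is exactly (CORE);
* `two_triads`: the degenerate cases `n₁ = 0` / `n₂ = 0` and the symmetric assembly;
* `rankTwoAdditivity_of_core`: a triad decomposition of length `tensorRank S ≤ 2`
  (`exists_triad_decomposition_tensorRank`), padded with zero triads, closes the route statement.

Supports item `stmt-MatrixMultiplication-4964`; no definitions are introduced.
-/

namespace Summit.MatrixMultiplication.MatrixMultiplication.Theorems.RankTwoAdditivity

open scoped BigOperators ComplexConjugate
open Literature.Computability.AlgebraicComplexity

/-- The contraction of a single triad `w ⊗ u ⊗ v` against `⟨n,n,n⟩` is the pairing of `w` with the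
matrix product `X Y`, `X_{κμ} = u(κ,μ)`, `Y_{μν} = v(μ,ν)`. [folklore] -/
theorem triad_contraction (n : ℕ) (w u v : Fin n × Fin n → ℂ) :
    (∑ b : Fin n × Fin n, ∑ c : Fin n × Fin n,
        if b.2 = c.1 then w (b.1, c.2) * u b * v c else 0) =
      ∑ a : Fin n × Fin n, w a * ∑ μ, u (a.1, μ) * v (μ, a.2) := by
  rw [Fintype.sum_prod_type, Fintype.sum_prod_type]
  refine Finset.sum_congr rfl fun κ _ => ?_
  have h : ∀ μ : Fin n, (∑ c : Fin n × Fin n,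
      if (κ, μ).2 = c.1 then w ((κ, μ).1, c.2) * u (κ, μ) * v c else 0) =
      ∑ ν, w (κ, ν) * (u (κ, μ) * v (μ, ν)) := by
    intro μ
    rw [Fintype.sum_prod_type, Finset.sum_comm]
    refine Finset.sum_congr rfl fun ν _ => ?_
    rw [Finset.sum_ite_eq Finset.univ μ]
    simp only [Finset.mem_univ, if_true]
    ring
  simp_rw [h]
  rw [Finset.sum_comm]
  refine Finset.sum_congr rfl fun ν _ => ?_
  rw [Finset.mul_sum]

/-- One-sided third-factor elimination: assuming `n₁ = ‖X₁‖²‖Y₁‖² ≠ 0`, the core inequality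
`hcore` (CORE, in coordinates) gives
`|t₁ + t₂|² ≤ 2‖S‖²` for `S = w₁⊗u₁⊗v₁ + w₂⊗u₂⊗v₂`, `t_l = Σ_a w_l(a)·(X_lY_l)(a)`. [folklore] -/
theorem zstep_one {ι κ μ : Type*} [Fintype ι] [Fintype κ] [Fintype μ]
    (w₁ w₂ : ι × μ → ℂ) (u₁ u₂ : ι × κ → ℂ) (v₁ v₂ : κ × μ → ℂ) (A B : ι × μ → ℂ)
    (hA : ∀ a, A a = ∑ m, u₁ (a.1, m) * v₁ (m, a.2))
    (hn : (∑ b, ‖u₁ b‖ ^ 2) * (∑ c, ‖v₁ c‖ ^ 2) ≠ 0)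
    (hcore : ((∑ b, ‖u₁ b‖ ^ 2) * ∑ c, ‖v₁ c‖ ^ 2) * (∑ a, ‖B a‖ ^ 2)
      + ((∑ b, ‖u₂ b‖ ^ 2) * ∑ c, ‖v₂ c‖ ^ 2) * (∑ a, ‖A a‖ ^ 2)
      + 2 * ‖(∑ b, conj (u₁ b) * u₂ b) * ∑ c, conj (v₁ c) * v₂ c‖ ^ 2
    ≤ 2 * ((∑ b, ‖u₁ b‖ ^ 2) * ∑ c, ‖v₁ c‖ ^ 2) * ((∑ b, ‖u₂ b‖ ^ 2) * ∑ c, ‖v₂ c‖ ^ 2)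
      + 2 * (conj ((∑ b, conj (u₁ b) * u₂ b) * ∑ c, conj (v₁ c) * v₂ c)
              * ∑ a, conj (A a) * B a).re) :
    ‖∑ a, (w₁ a * A a + w₂ a * B a)‖ ^ 2 ≤
      2 * ∑ a, ∑ b, ∑ c, ‖w₁ a * u₁ b * v₁ c + w₂ a * u₂ b * v₂ c‖ ^ 2 := by
  -- the norm of `S` (stated before naming, so that `set` rewrites it together with `hcore`)
  have hN := norm_sq_two_triads w₁ w₂ u₁ u₂ v₁ v₂
  -- names
  set nu₁ : ℝ := ∑ b, ‖u₁ b‖ ^ 2 with hnu₁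
  set nv₁ : ℝ := ∑ c, ‖v₁ c‖ ^ 2 with hnv₁
  set nu₂ : ℝ := ∑ b, ‖u₂ b‖ ^ 2 with hnu₂
  set nv₂ : ℝ := ∑ c, ‖v₂ c‖ ^ 2 with hnv₂
  set nw₁ : ℝ := ∑ a, ‖w₁ a‖ ^ 2 with hnw₁
  set nw₂ : ℝ := ∑ a, ‖w₂ a‖ ^ 2 with hnw₂
  set n₁ : ℝ := nu₁ * nv₁ with hn₁
  set n₂ : ℝ := nu₂ * nv₂ with hn₂
  set x : ℂ := ∑ b, conj (u₁ b) * u₂ b with hx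
  set y : ℂ := ∑ c, conj (v₁ c) * v₂ c with hy
  set zc : ℂ := ∑ a, conj (w₁ a) * w₂ a with hzc
  set p : ℂ := x * y with hp
  set q : ℂ := ∑ a, conj (A a) * B a with hq
  set Aq : ℝ := ∑ a, ‖A a‖ ^ 2 with hAq
  set Bq : ℝ := ∑ a, ‖B a‖ ^ 2 with hBq
  set t₁ : ℂ := ∑ a, w₁ a * A a with ht₁
  set t₂ : ℂ := ∑ a, w₂ a * B a with ht₂
  -- nonnegativity
  have hnu₁0 : 0 ≤ nu₁ := Finset.sum_nonneg fun _ _ => by positivity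
  have hnv₁0 : 0 ≤ nv₁ := Finset.sum_nonneg fun _ _ => by positivity
  have hnu₂0 : 0 ≤ nu₂ := Finset.sum_nonneg fun _ _ => by positivity
  have hnv₂0 : 0 ≤ nv₂ := Finset.sum_nonneg fun _ _ => by positivity
  have hnw₂0 : 0 ≤ nw₂ := Finset.sum_nonneg fun _ _ => by positivity
  have hAq0 : 0 ≤ Aq := Finset.sum_nonneg fun _ _ => by positivity
  have hn₁0 : 0 ≤ n₁ := by rw [hn₁]; exact mul_nonneg hnu₁0 hnv₁0
  clear_value nu₁ nv₁ nu₂ nv₂ nw₁ nw₂ n₁ n₂ x y zc p q Aq Bq t₁ t₂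
  have hn₁pos : 0 < n₁ := lt_of_le_of_ne hn₁0 (Ne.symm hn)
  -- |p|² ≤ n₁ n₂ (Cauchy–Schwarz twice)
  have hx2 : ‖x‖ ^ 2 ≤ nu₁ * nu₂ := by rw [hx, hnu₁, hnu₂]; exact norm_sq_hsum_le u₁ u₂
  have hy2 : ‖y‖ ^ 2 ≤ nv₁ * nv₂ := by rw [hy, hnv₁, hnv₂]; exact norm_sq_hsum_le v₁ v₂
  have hp2 : ‖p‖ ^ 2 ≤ n₁ * n₂ := by
    rw [hp, norm_mul, mul_pow]
    calc ‖x‖ ^ 2 * ‖y‖ ^ 2 ≤ (nu₁ * nu₂) * (nv₁ * nv₂) :=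
          mul_le_mul hx2 hy2 (by positivity) (by positivity)
      _ = n₁ * n₂ := by rw [hn₁, hn₂]; ring
  set s : ℝ := n₁ * n₂ - ‖p‖ ^ 2 with hs
  have hs0 : 0 ≤ s := by rw [hs]; linarith
  -- `‖A‖² ≤ n₁`
  have hAn : Aq ≤ n₁ := by rw [hAq, hn₁, hnu₁, hnv₁]; exact norm_sq_mul_le u₁ v₁ A hA
  -- auxiliary arrays
  set U : ι × μ → ℂ := fun a => (n₁ : ℂ) * conj (w₁ a) + conj p * conj (w₂ a) with hU
  set D : ι × μ → ℂ := fun a => (n₁ : ℂ) * B a - p * A a with hD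
  set F : ℝ := ∑ a, ‖U a‖ ^ 2 with hF
  set Dq : ℝ := ∑ a, ‖D a‖ ^ 2 with hDq
  have hF0 : 0 ≤ F := Finset.sum_nonneg fun _ _ => by positivity
  have hUdef : ∀ a, U a = (n₁ : ℂ) * conj (w₁ a) + conj p * conj (w₂ a) := fun a => by rw [hU]
  have hDdef : ∀ a, D a = (n₁ : ℂ) * B a - p * A a := fun a => by rw [hD]
  clear_value U D F Dq
  -- (i) linear identity  n₁ (t₁ + t₂) = ⟨U, A⟩ + ⟨conj w₂, D⟩
  have hlin : (n₁ : ℂ) * (t₁ + t₂) =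
      (∑ a, conj (U a) * A a) + ∑ a, conj (conj (w₂ a)) * D a := by
    rw [ht₁, ht₂, ← Finset.sum_add_distrib, Finset.mul_sum, ← Finset.sum_add_distrib]
    refine Finset.sum_congr rfl fun a _ => ?_
    rw [hUdef, hDdef]
    simp only [map_add, map_mul, Complex.conj_conj, Complex.conj_ofReal]
    ring
  -- (ii) quadratic identity  n₁ N = ‖U‖² + s ‖w₂‖²
  have hconjzc : (∑ a, w₁ a * conj (w₂ a)) = conj zc := by
    rw [hzc, map_sum]
    refine Finset.sum_congr rfl fun a _ => ?_
    rw [map_mul, Complex.conj_conj]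
  have hFexp : F = n₁ ^ 2 * nw₁ + ‖p‖ ^ 2 * nw₂ + 2 * (n₁ * (zc * p).re) := by
    have h := norm_sq_add_sum (fun a => (n₁ : ℂ) * conj (w₁ a)) (fun a => conj p * conj (w₂ a))
    have e1 : (∑ a, ‖(n₁ : ℂ) * conj (w₁ a)‖ ^ 2) = n₁ ^ 2 * nw₁ := by
      rw [hnw₁, Finset.mul_sum]
      refine Finset.sum_congr rfl fun a _ => ?_
      rw [norm_mul, Complex.norm_real, Real.norm_of_nonneg hn₁0, Complex.norm_conj, mul_pow]
    have e2 : (∑ a, ‖conj p * conj (w₂ a)‖ ^ 2) = ‖p‖ ^ 2 * nw₂ := by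
      rw [hnw₂, Finset.mul_sum]
      refine Finset.sum_congr rfl fun a _ => ?_
      rw [norm_mul, Complex.norm_conj, Complex.norm_conj, mul_pow]
    have e3 : (∑ a, conj ((n₁ : ℂ) * conj (w₁ a)) * (conj p * conj (w₂ a))) =
        (n₁ : ℂ) * conj (zc * p) := by
      rw [map_mul (starRingEnd ℂ) zc p, ← hconjzc, Finset.sum_mul, Finset.mul_sum]
      refine Finset.sum_congr rfl fun a _ => ?_
      simp only [map_mul, Complex.conj_conj, Complex.conj_ofReal]
      ring
    have hF' : F = ∑ a, ‖(n₁ : ℂ) * conj (w₁ a) + conj p * conj (w₂ a)‖ ^ 2 := by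
      rw [hF]; exact Finset.sum_congr rfl fun a _ => by rw [hUdef]
    rw [hF', h, e1, e2, e3, Complex.re_ofReal_mul, Complex.conj_re]
  have hquad : n₁ * (nw₁ * n₁ + nw₂ * n₂ + 2 * (zc * p).re) = F + s * nw₂ := by
    rw [hFexp, hs]
    ring
  -- (iii) the defect bound from the core: Dq ≤ (2 n₁ − Aq) s
  have hconjq : (∑ a, conj (B a) * A a) = conj q := by
    rw [hq, map_sum]
    refine Finset.sum_congr rfl fun a _ => ?_
    rw [map_mul, Complex.conj_conj, mul_comm]
  have hDqexp : Dq = n₁ ^ 2 * Bq + ‖p‖ ^ 2 * Aq - 2 * n₁ * (conj p * q).re := by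
    have h := norm_sq_add_sum (fun a => (n₁ : ℂ) * B a) (fun a => -(p * A a))
    have e1 : (∑ a, ‖(n₁ : ℂ) * B a‖ ^ 2) = n₁ ^ 2 * Bq := by
      rw [hBq, Finset.mul_sum]
      refine Finset.sum_congr rfl fun a _ => ?_
      rw [norm_mul, Complex.norm_real, Real.norm_of_nonneg hn₁0, mul_pow]
    have e2 : (∑ a, ‖-(p * A a)‖ ^ 2) = ‖p‖ ^ 2 * Aq := by
      rw [hAq, Finset.mul_sum]
      refine Finset.sum_congr rfl fun a _ => ?_
      rw [norm_neg, norm_mul, mul_pow]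
    have e3 : (∑ a, conj ((n₁ : ℂ) * B a) * -(p * A a)) = -((n₁ : ℂ) * (p * conj q)) := by
      rw [← hconjq, Finset.mul_sum, Finset.mul_sum, ← Finset.sum_neg_distrib]
      refine Finset.sum_congr rfl fun a _ => ?_
      simp only [map_mul, Complex.conj_ofReal]
      ring
    have e4 : (p * conj q).re = (conj p * q).re := by
      rw [← Complex.conj_re (p * conj q), map_mul, Complex.conj_conj]
    have hDq' : Dq = ∑ a, ‖(n₁ : ℂ) * B a + -(p * A a)‖ ^ 2 := by
      rw [hDq]; exact Finset.sum_congr rfl fun a _ => by rw [hDdef, sub_eq_add_neg]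
    rw [hDq', h, e1, e2, e3, Complex.neg_re, Complex.re_ofReal_mul, e4]
    ring
  have hDle : Dq ≤ (2 * n₁ - Aq) * s := by
    have h := mul_le_mul_of_nonneg_left hcore hn₁0
    rw [hDqexp, hs]
    nlinarith [h]
  -- (iv) Cauchy–Schwarz for the two pairings
  have hα : ‖∑ a, conj (U a) * A a‖ ^ 2 ≤ F * Aq := by rw [hF, hAq]; exact norm_sq_hsum_le U A
  have hβ : ‖∑ a, conj (conj (w₂ a)) * D a‖ ^ 2 ≤ nw₂ * Dq := by
    have := norm_sq_hsum_le (fun a => conj (w₂ a)) D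
    rw [hnw₂, hDq]
    simpa only [Complex.norm_conj] using this
  -- (v) assemble
  have hreal := zstep_real ‖∑ a, conj (U a) * A a‖ ‖∑ a, conj (conj (w₂ a)) * D a‖ F Aq nw₂ Dq n₁ s
    hF0 hnw₂0 hs0 hAq0 hα hβ hDle hAn
  have h1 : ‖(n₁ : ℂ) * (t₁ + t₂)‖ ^ 2 ≤ 2 * n₁ * (F + s * nw₂) := by
    rw [hlin]
    exact (pow_le_pow_left₀ (norm_nonneg _) (norm_add_le _ _) 2).trans hreal
  have h2 : ‖t₁ + t₂‖ ^ 2 ≤ 2 * (nw₁ * n₁ + nw₂ * n₂ + 2 * (zc * p).re) := by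
    rw [norm_mul, mul_pow, Complex.norm_real, Real.norm_of_nonneg hn₁0] at h1
    rw [← hquad] at h1
    have h3 : n₁ ^ 2 * ‖t₁ + t₂‖ ^ 2 ≤ n₁ ^ 2 * (2 * (nw₁ * n₁ + nw₂ * n₂ + 2 * (zc * p).re)) := by
      calc n₁ ^ 2 * ‖t₁ + t₂‖ ^ 2 ≤ 2 * n₁ * (n₁ * (nw₁ * n₁ + nw₂ * n₂ + 2 * (zc * p).re)) := h1
        _ = _ := by ring
    exact le_of_mul_le_mul_left h3 (by positivity)
  have ht : (∑ a, (w₁ a * A a + w₂ a * B a)) = t₁ + t₂ := by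
    rw [ht₁, ht₂, ← Finset.sum_add_distrib]
  rw [ht, hN]
  exact h2

/-- **Two triads.** For `S = w₁⊗u₁⊗v₁ + w₂⊗u₂⊗v₂`: `|⟨S,⟨n,n,n⟩⟩|² ≤ 2‖S‖²`, in array form,
assuming the core inequality for both orderings of the two triads (`hcore`, `hcore'`). [folklore] -/
theorem two_triads {ι κ μ : Type*} [Fintype ι] [Fintype κ] [Fintype μ]
    (w₁ w₂ : ι × μ → ℂ) (u₁ u₂ : ι × κ → ℂ) (v₁ v₂ : κ × μ → ℂ) (A B : ι × μ → ℂ)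
    (hA : ∀ a, A a = ∑ m, u₁ (a.1, m) * v₁ (m, a.2))
    (hB : ∀ a, B a = ∑ m, u₂ (a.1, m) * v₂ (m, a.2))
    (hcore : ((∑ b, ‖u₁ b‖ ^ 2) * ∑ c, ‖v₁ c‖ ^ 2) * (∑ a, ‖B a‖ ^ 2)
      + ((∑ b, ‖u₂ b‖ ^ 2) * ∑ c, ‖v₂ c‖ ^ 2) * (∑ a, ‖A a‖ ^ 2)
      + 2 * ‖(∑ b, conj (u₁ b) * u₂ b) * ∑ c, conj (v₁ c) * v₂ c‖ ^ 2
    ≤ 2 * ((∑ b, ‖u₁ b‖ ^ 2) * ∑ c, ‖v₁ c‖ ^ 2) * ((∑ b, ‖u₂ b‖ ^ 2) * ∑ c, ‖v₂ c‖ ^ 2)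
      + 2 * (conj ((∑ b, conj (u₁ b) * u₂ b) * ∑ c, conj (v₁ c) * v₂ c)
              * ∑ a, conj (A a) * B a).re)
    (hcore' : ((∑ b, ‖u₂ b‖ ^ 2) * ∑ c, ‖v₂ c‖ ^ 2) * (∑ a, ‖A a‖ ^ 2)
      + ((∑ b, ‖u₁ b‖ ^ 2) * ∑ c, ‖v₁ c‖ ^ 2) * (∑ a, ‖B a‖ ^ 2)
      + 2 * ‖(∑ b, conj (u₂ b) * u₁ b) * ∑ c, conj (v₂ c) * v₁ c‖ ^ 2
    ≤ 2 * ((∑ b, ‖u₂ b‖ ^ 2) * ∑ c, ‖v₂ c‖ ^ 2) * ((∑ b, ‖u₁ b‖ ^ 2) * ∑ c, ‖v₁ c‖ ^ 2)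
      + 2 * (conj ((∑ b, conj (u₂ b) * u₁ b) * ∑ c, conj (v₂ c) * v₁ c)
              * ∑ a, conj (B a) * A a).re) :
    ‖∑ a, (w₁ a * A a + w₂ a * B a)‖ ^ 2 ≤
      2 * ∑ a, ∑ b, ∑ c, ‖w₁ a * u₁ b * v₁ c + w₂ a * u₂ b * v₂ c‖ ^ 2 := by
  by_cases h₁ : (∑ b, ‖u₁ b‖ ^ 2) * (∑ c, ‖v₁ c‖ ^ 2) = 0
  · by_cases h₂ : (∑ b, ‖u₂ b‖ ^ 2) * (∑ c, ‖v₂ c‖ ^ 2) = 0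
    · -- both products vanish: `A = B = 0`
      have hA0 := prod_eq_zero_of_norms u₁ v₁ A hA h₁
      have hB0 := prod_eq_zero_of_norms u₂ v₂ B hB h₂
      have hz : (∑ a, (w₁ a * A a + w₂ a * B a)) = 0 :=
        Finset.sum_eq_zero fun a _ => by rw [hA0, hB0]; ring
      rw [hz, norm_zero, zero_pow two_ne_zero]
      exact mul_nonneg zero_le_two (Finset.sum_nonneg fun _ _ => Finset.sum_nonneg fun _ _ =>
        Finset.sum_nonneg fun _ _ => by positivity)
    · -- swap the roles of the two triads
      have h := zstep_one w₂ w₁ u₂ u₁ v₂ v₁ B A hB h₂ hcore'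
      have e1 : (∑ a, (w₁ a * A a + w₂ a * B a)) = ∑ a, (w₂ a * B a + w₁ a * A a) :=
        Finset.sum_congr rfl fun a _ => add_comm _ _
      have e2 : (∑ a, ∑ b, ∑ c, ‖w₁ a * u₁ b * v₁ c + w₂ a * u₂ b * v₂ c‖ ^ 2) =
          ∑ a, ∑ b, ∑ c, ‖w₂ a * u₂ b * v₂ c + w₁ a * u₁ b * v₁ c‖ ^ 2 :=
        Finset.sum_congr rfl fun a _ => Finset.sum_congr rfl fun b _ =>
          Finset.sum_congr rfl fun c _ => by rw [add_comm]
      rw [e1, e2]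
      exact h
  · exact zstep_one w₁ w₂ u₁ u₂ v₁ v₂ A B hA h₁ hcore

/-- Contraction of a sum of two triads against `⟨n,n,n⟩`. [folklore] -/
theorem contraction_two (n : ℕ) (S : Fin n × Fin n → Fin n × Fin n → Fin n × Fin n → ℂ)
    (w₁ w₂ u₁ u₂ v₁ v₂ : Fin n × Fin n → ℂ)
    (hS : ∀ a b c, S a b c = w₁ a * u₁ b * v₁ c + w₂ a * u₂ b * v₂ c) :
    ∑ a, ∑ b, ∑ c, S a b c * matMulTensor ℂ n n n a b c =
      ∑ a : Fin n × Fin n, (w₁ a * (∑ μ, u₁ (a.1, μ) * v₁ (μ, a.2))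
        + w₂ a * (∑ μ, u₂ (a.1, μ) * v₂ (μ, a.2))) := by
  rw [flatteningWitness_contraction, Finset.sum_add_distrib, ← triad_contraction, ← triad_contraction,
    ← Finset.sum_add_distrib]
  refine Finset.sum_congr rfl fun b _ => ?_
  rw [← Finset.sum_add_distrib]
  refine Finset.sum_congr rfl fun c _ => ?_
  split_ifs with h
  · rw [hS]
  · simp

/-- **Reduction.** `RankTwoAdditivity` (item `stmt-MatrixMultiplication-4964`, `M(n,2) = 2`) follows
from the core four-matrix inequality (CORE) for square index types `Fin n`. [folklore] -/
theorem rankTwoAdditivity_of_core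
    (hcore : ∀ {n : ℕ} (u₁ u₂ : Fin n × Fin n → ℂ) (v₁ v₂ : Fin n × Fin n → ℂ)
      (A B : Fin n × Fin n → ℂ), (∀ a, A a = ∑ m, u₁ (a.1, m) * v₁ (m, a.2)) →
      (∀ a, B a = ∑ m, u₂ (a.1, m) * v₂ (m, a.2)) →
      ((∑ b, ‖u₁ b‖ ^ 2) * ∑ c, ‖v₁ c‖ ^ 2) * (∑ a, ‖B a‖ ^ 2)
        + ((∑ b, ‖u₂ b‖ ^ 2) * ∑ c, ‖v₂ c‖ ^ 2) * (∑ a, ‖A a‖ ^ 2)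
        + 2 * ‖(∑ b, conj (u₁ b) * u₂ b) * ∑ c, conj (v₁ c) * v₂ c‖ ^ 2
      ≤ 2 * ((∑ b, ‖u₁ b‖ ^ 2) * ∑ c, ‖v₁ c‖ ^ 2) * ((∑ b, ‖u₂ b‖ ^ 2) * ∑ c, ‖v₂ c‖ ^ 2)
        + 2 * (conj ((∑ b, conj (u₁ b) * u₂ b) * ∑ c, conj (v₁ c) * v₂ c)
                * ∑ a, conj (A a) * B a).re) :
    Summit.MatrixMultiplication.MatrixMultiplication.Theses.FidelityWitnesses.RankTwoAdditivity := by
  unfold Summit.MatrixMultiplication.MatrixMultiplication.Theses.FidelityWitnesses.RankTwoAdditivity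
  intro n S hS
  classical
  obtain ⟨w, u, v, hdec⟩ := exists_triad_decomposition_tensorRank S
  -- generalize over the length of the decomposition
  have key : ∀ r : ℕ, r ≤ 2 → ∀ (w u v : Fin r → Fin n × Fin n → ℂ),
      S = ∑ i, triad (w i) (u i) (v i) →
      ‖∑ a, ∑ b, ∑ c, S a b c * matMulTensor ℂ n n n a b c‖ ^ 2 ≤
        2 * ∑ a, ∑ b, ∑ c, ‖S a b c‖ ^ 2 := by
    intro r hr w u v hdec
    have hSabc : ∀ a b c, S a b c = ∑ i, w i a * u i b * v i c := by
      intro a b c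
      have h := congrFun (congrFun (congrFun hdec a) b) c
      rw [h]
      simp only [Finset.sum_apply, triad_apply]
    -- two named triads (padding with zero when `r < 2`)
    obtain ⟨w₁, w₂, u₁, u₂, v₁, v₂, hS2⟩ : ∃ w₁ w₂ u₁ u₂ v₁ v₂ : Fin n × Fin n → ℂ,
        ∀ a b c, S a b c = w₁ a * u₁ b * v₁ c + w₂ a * u₂ b * v₂ c := by
      interval_cases r
      · exact ⟨0, 0, 0, 0, 0, 0, fun a b c => by rw [hSabc]; simp⟩
      · exact ⟨w 0, 0, u 0, 0, v 0, 0, fun a b c => by rw [hSabc, Fin.sum_univ_one]; simp⟩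
      · exact ⟨w 0, w 1, u 0, u 1, v 0, v 1, fun a b c => by rw [hSabc, Fin.sum_univ_two]⟩
    rw [contraction_two n S w₁ w₂ u₁ u₂ v₁ v₂ hS2]
    have hnorm : (∑ a, ∑ b, ∑ c, ‖S a b c‖ ^ 2) =
        ∑ a, ∑ b, ∑ c, ‖w₁ a * u₁ b * v₁ c + w₂ a * u₂ b * v₂ c‖ ^ 2 :=
      Finset.sum_congr rfl fun a _ => Finset.sum_congr rfl fun b _ =>
        Finset.sum_congr rfl fun c _ => by rw [hS2]
    rw [hnorm]
    exact two_triads w₁ w₂ u₁ u₂ v₁ v₂ _ _ (fun a => rfl) (fun a => rfl)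
      (hcore u₁ u₂ v₁ v₂ _ _ (fun a => rfl) (fun a => rfl))
      (hcore u₂ u₁ v₂ v₁ _ _ (fun a => rfl) (fun a => rfl))
  exact key (tensorRank S) hS w u v hdec

end Summit.MatrixMultiplication.MatrixMultiplication.Theorems.RankTwoAdditivity
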